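import Summits.NavierStokesRegularity.FunctionalMining.TopEigHeatConvex
import Summits.NavierStokesRegularity.FunctionalMining.ThreeWaveStrain
import HarnessLib

/-!
# FunctionalMining / NoGo — K10a: the second-difference FLOOR of the symmetrised top–bottom
# core density on symmetric trace-free `3 × 3` tensors (door D-K6 (c), finite-dimensional side)

HONEST FRAMING. Search for candidate a priori estimates; no regularity claim. Nothing about
Navier–Stokes is proved or asserted in this file: finite-dimensional inequalities for flat
`3 × 3` tensors (and, in K10b, two lemmas of one-variable real analysis). Cell `pub-nsfunc`,
no-go seat (gen 38), kernel candidate K10 = three files K10a `NoGo/TopBotEigSplitFloor`,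
K10b `NoGo/TopBotEigSplitCeiling`, K10c `NoGo/TopBotEigSplitting` (this order of imports).

THE TARGET. The staged K9 `NoGo/TopBotEigHeatCoerciveSplit` reduced the door-(c) node
`TopBotEigHeatCoercivePos q` (real `q > 2`: heat coercivity of the symmetrised core `Φ_q + Ψ_q`)
to the finite-dimensional obligation `TopEig.TopBotEigSplitting q c` with a share `c > 0`:
`M ≥ 0` and a convex `1`-Lipschitz `h ≥ 0` on flat tensors with
`λ(A)^q + λ(−A)^q = M·h(A)^q + c·‖A‖^q` for every symmetric trace-free `A` (`λ = TopEig.lam`, the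
top Rayleigh value of the tree; `λ(S) = λ₁`, `λ(−S) = −λ₃` on a strain). K10 PROVES
`∃ c > 0, TopBotEigSplitting q c` for EVERY REAL `q ≥ 2` (K10c
`TopEig.topBotEigSplitting_exists`, the obligation written out word for word), by an elementary
SECOND-DIFFERENCE argument that uses no eigenvalue calculus beyond `λ`: no Lewis–Sendov / Davis
spectral-function theory, no smoothness of eigenvalues, no majorisation.

WHAT IS PROVED HERE [ours]:
* §1 spectral bookkeeping for a symmetric flat tensor `A` (`flatMat`, ordered eigenvalues `flatEv`
  via the Literature Ky Fan file): `λ(A) = λ₁`, `λ(−A) = −λ₃`, `Σλᵢ = tr A`, `‖A‖² = Σλᵢ²`, and for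
  trace-free `A` the identity **`λ(A)² + λ(−A)² = ‖A‖²/3 + (4/3)·g(A)²`**, `g = (λ(A) + λ(−A))/2`
  (`TopEig.lam_sq_add_lam_neg_sq_eq`; the K7 identity, now for general symmetric trace-free `A`).
* §2 the predicate `IsSymTF` and its closure under `+, −, •`; `λ(tA) = tλ(A)` (`t ≥ 0`); the CORE
  DENSITY `coreDensity q A = (λ(A)²)^{q/2} + (λ(−A)²)^{q/2}` (`= λ(A)^q + λ(−A)^q` on symmetric
  trace-free tensors, `coreDensity_eq`; even, non-negative, `q`-homogeneous, continuous) and the NORM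
  DENSITY `normDensity q A = (‖A‖²)^{q/2} = ‖A‖^q`; `2(‖A‖²/36)^{q/2} ≤ f_q(A) ≤ 2‖A‖^q`.
* §3 the tangent line of `s ↦ s^p` (`p ≥ 1`, Bernoulli), squares of non-negative convex functions
  have non-negative second differences, `g` is convex, and the **SECOND-DIFFERENCE FLOOR**
  `TopEig.coreDensity_secondDiff_ge (hq : 2 ≤ q) : q/3·(‖B‖²/36)^{q/2−1}·‖X‖² ≤
  f_q(B+X) + f_q(B−X) − 2f_q(B)` for symmetric trace-free `B, X` (tangent line of `s ↦ s^{q/2}` at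
  `λ(B)²`, `λ(−B)²`; the floors `λ(±B)² ≥ ‖B‖²/36` from the tree's `norm_le_six_mul_lam`; §1 and
  the parallelogram law give the sum `λ(·)² + λ(−·)²` second differences `≥ (2/3)‖X‖²`).

WHAT IS NOT PROVED HERE. Anything global: the ceiling for the norm density, the split density and
the convexity statements are K10b/K10c. No constant is claimed sharp.

PROVENANCE / STATUS. Typed and farm-checked by the no-go seat (gen 38): K10a stand-alone, K10b and
K10c as concatenations with their imports (evidence `pub-nsfunc-nogo/sieveld/ktg/`, incl. the
K9∘K10 JOINT check `TopBotEigHeatCoercivePos q` for every real `q > 2` and the value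
`shareConst 4 = 1/999`); STATUS: STAGED (`pub-nsfunc-nogo/NoGo/<name>.STAGING.lean`), filing by a
prove seat on the lead's word, in the order K10a → K10b → K10c, after K7/K8/K9 (the planner seat
cannot file under `FunctionalMining/`). Search for candidate a priori estimates; no regularity
claim. [ours; K1-Q6 (c) = door D-K6 (c), finite-dimensional side, `q ≥ 2`]
FILING (prove seat g26, REQUEST #24a): declarations byte-identical to the no-go seat's staged `TopBotEigSplitFloor.STAGING.lean` 09e84ec8fe019ab7; this FILING line plus 23 one-line docstrings added for the gate's lint.docstring (flatMat_apply/_neg/_isHermitian/_isSymm, IsSymTF.zero/add/neg/sub/smul/lam_nonneg/lam_neg_nonneg/norm_sq_le_neg, sq_rpow_half, coreDensity_*/normDensity_* bookkeeping, continuous_*) and 26 blank lines above one-line docstrings removed to stay under the 400-line cap; declarations themselves byte-identical; these are the only changes.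
-/

noncomputable section

open Finset Set Real

namespace Summit.NavierStokesRegularity.FunctionalMining

namespace TopEig

/-! ## 1. Spectral bookkeeping for a general symmetric trace-free flat tensor -/

/-- Flat `3 × 3` tensors `EuclideanSpace ℝ (Fin 3 × Fin 3)` (the values of `∇u` and of the strain `S`); a
reducible abbreviation, not a new object. [ours; bookkeeping] -/
abbrev Tens3 : Type := EuclideanSpace ℝ (Fin 3 × Fin 3)
/-- The matrix of a flat tensor. [bookkeeping] -/
def flatMat (A : Tens3) : Matrix (Fin 3) (Fin 3) ℝ := Matrix.of fun i j => A (i, j)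
/-- Entries of `flatMat`. [bookkeeping] -/
@[simp] theorem flatMat_apply (A : Tens3) (i j : Fin 3) : flatMat A i j = A (i, j) := rfl
/-- `flatMat (−A) = −flatMat A`. [bookkeeping] -/
theorem flatMat_neg (A : Tens3) : flatMat (-A) = -flatMat A := by
  ext i j; simp [flatMat]
/-- The matrix of a symmetric flat tensor is Hermitian. [bookkeeping] -/
theorem flatMat_isHermitian {A : Tens3} (hsym : ∀ i j, A (i, j) = A (j, i)) :
    (flatMat A).IsHermitian := by
  unfold Matrix.IsHermitian
  ext i j
  simp [Matrix.conjTranspose_apply, flatMat, hsym j i]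
/-- The matrix of a symmetric flat tensor is symmetric. [bookkeeping] -/
theorem flatMat_isSymm {A : Tens3} (hsym : ∀ i j, A (i, j) = A (j, i)) : (flatMat A).IsSymm := by
  unfold Matrix.IsSymm
  ext i j
  simp [flatMat, hsym j i]
/-- The three sorted eigenvalues `e 0 ≥ e 1 ≥ e 2` of a symmetric flat tensor. [bookkeeping] -/
def flatEv {A : Tens3} (hsym : ∀ i j, A (i, j) = A (j, i)) (k : Fin 3) : ℝ :=
  (flatMat_isHermitian hsym).eigenvalues₀ (Fin.cast (Fintype.card_fin 3).symm k)

/-- `λ(A) = e 0`. [folklore; tree `lam_eq_eigenvalues₀`] -/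
theorem lam_eq_ev {A : Tens3} (hsym : ∀ i j, A (i, j) = A (j, i)) : lam A = flatEv hsym 0 := by
  have hn : 1 ≤ Fintype.card (Fin 3) := by simp
  rw [lam_eq_eigenvalues₀ (flatMat_isHermitian hsym) (fun i j => rfl) hn, flatEv]
  congr 1

/-- `λ(−A) = −e 2`. [folklore; Horn–Johnson Obs. 4.2.5 via the tree's Ky Fan file] -/
theorem lam_neg_eq_ev {A : Tens3} (hsym : ∀ i j, A (i, j) = A (j, i)) : lam (-A) = -flatEv hsym 2 := by
  have hn : 1 ≤ Fintype.card (Fin 3) := by simp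
  have hsym' : ∀ i j, (-A) (i, j) = (-A) (j, i) := fun i j => by
    simp only [WithLp.ofLp_neg, Pi.neg_apply, hsym i j]
  have hH' : (-flatMat A).IsHermitian := by rw [← flatMat_neg]; exact flatMat_isHermitian hsym'
  have h1 : lam (-A) = hH'.eigenvalues₀ (Fin.castLE hn 0) :=
    lam_eq_eigenvalues₀ hH' (fun i j => by simp [flatMat]) hn
  rw [h1, Literature.Analysis.Matrix.KyFan.eigenvalues₀_neg (flatMat_isHermitian hsym) hH', flatEv]
  congr 2

/-- `e 0 + e 1 + e 2 = tr A`. [folklore; Horn–Johnson Thm. 4.3.47 via the tree's Ky Fan file] -/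
theorem ev_sum {A : Tens3} (hsym : ∀ i j, A (i, j) = A (j, i)) :
    flatEv hsym 0 + flatEv hsym 1 + flatEv hsym 2 = ∑ i, A (i, i) := by
  have h := Literature.Analysis.Matrix.KyFan.sum_eigenvalues₀_eq_trace (flatMat_isHermitian hsym)
  rw [← Equiv.sum_comp (finCongr (Fintype.card_fin 3).symm), Fin.sum_univ_three] at h
  simp only [Matrix.trace, Matrix.diag, flatMat_apply] at h
  exact h

/-- `‖A‖² = e 0² + e 1² + e 2²` for a symmetric flat tensor (`‖A‖² = ∑ Aᵢⱼ² = tr M² = ∑ λₖ²`).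
[folklore; dictionary `MiddleEigenKill.trace_mul_self_eq_sum_sq(_entries)`] -/
theorem norm_sq_eq_ev {A : Tens3} (hsym : ∀ i j, A (i, j) = A (j, i)) :
    ‖A‖ ^ 2 = flatEv hsym 0 ^ 2 + flatEv hsym 1 ^ 2 + flatEv hsym 2 ^ 2 := by
  have h1 : ‖A‖ ^ 2 = ∑ i, ∑ j, flatMat A i j ^ 2 := by
    rw [EuclideanSpace.norm_sq_eq, Fintype.sum_prod_type]
    simp [flatMat, sq_abs]
  have h2 : ∑ i, (flatMat_isHermitian hsym).eigenvalues i ^ 2 =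
      ∑ k, (flatMat_isHermitian hsym).eigenvalues₀ k ^ 2 :=
    Fintype.sum_equiv (Fintype.equivOfCardEq (Fintype.card_fin _)).symm _ _ (fun i => rfl)
  rw [h1, ← MiddleEigenKill.trace_mul_self_eq_sum_sq_entries (flatMat_isSymm hsym),
    MiddleEigenKill.trace_mul_self_eq_sum_sq (flatMat_isHermitian hsym), h2,
    ← Equiv.sum_comp (finCongr (Fintype.card_fin 3).symm), Fin.sum_univ_three]
  rfl

/-- **Half the spectral gap** `g(A) = (λ(A) + λ(−A))/2` (`= (e 0 − e 2)/2` on symmetric tensors).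
[ours; K7's admissible density] -/
def halfGapDensity (A : Tens3) : ℝ := (lam A + lam (-A)) / 2

/-- **`λ(A)² + λ(−A)² = ‖A‖²/3 + (4/3)·g(A)²`** on EVERY symmetric trace-free flat tensor
(`λ₁² + λ₃² = |A|²/3 + (λ₁ − λ₃)²/3` from `λ₂ = −λ₁ − λ₃` and `|A|² = ∑λₖ²`; K7 proved it at strain
values). [ours] -/
theorem lam_sq_add_lam_neg_sq_eq {A : Tens3} (hsym : ∀ i j, A (i, j) = A (j, i))
    (htr : ∑ i, A (i, i) = 0) :
    lam A ^ 2 + lam (-A) ^ 2 = ‖A‖ ^ 2 / 3 + 4 / 3 * halfGapDensity A ^ 2 := by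
  rw [halfGapDensity, lam_eq_ev hsym, lam_neg_eq_ev hsym, norm_sq_eq_ev hsym]
  have hm : flatEv hsym 1 = -flatEv hsym 0 - flatEv hsym 2 := by linarith [ev_sum hsym, htr]
  rw [hm]
  ring

/-! ## 2. Symmetric trace-free tensors; homogeneity of `λ`; the core density and the norm density -/

/-- Symmetric and trace-free (the strain values of divergence-free fields). [ours; bookkeeping] -/
structure IsSymTF (A : Tens3) : Prop where
  symm : ∀ i j, A (i, j) = A (j, i)
  tr : ∑ i, A (i, i) = 0

namespace IsSymTF
/-- `0` is symmetric trace-free. [bookkeeping] -/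
theorem zero : IsSymTF 0 := ⟨fun _ _ => by simp, by simp⟩
/-- Sums of symmetric trace-free tensors are symmetric trace-free. [bookkeeping] -/
theorem add {A B : Tens3} (hA : IsSymTF A) (hB : IsSymTF B) : IsSymTF (A + B) :=
  ⟨fun i j => by simp only [WithLp.ofLp_add, Pi.add_apply, hA.symm i j, hB.symm i j],
   by simp only [WithLp.ofLp_add, Pi.add_apply, sum_add_distrib, hA.tr, hB.tr, add_zero]⟩
/-- Negatives of symmetric trace-free tensors are symmetric trace-free. [bookkeeping] -/
theorem neg {A : Tens3} (hA : IsSymTF A) : IsSymTF (-A) :=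
  ⟨fun i j => by simp only [WithLp.ofLp_neg, Pi.neg_apply, hA.symm i j],
   by simp only [WithLp.ofLp_neg, Pi.neg_apply, sum_neg_distrib, hA.tr, neg_zero]⟩
/-- Differences of symmetric trace-free tensors are symmetric trace-free. [bookkeeping] -/
theorem sub {A B : Tens3} (hA : IsSymTF A) (hB : IsSymTF B) : IsSymTF (A - B) := by
  rw [sub_eq_add_neg]; exact hA.add hB.neg
/-- Scalar multiples of symmetric trace-free tensors are symmetric trace-free. [bookkeeping] -/
theorem smul {A : Tens3} (hA : IsSymTF A) (t : ℝ) : IsSymTF (t • A) :=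
  ⟨fun i j => by simp only [WithLp.ofLp_smul, Pi.smul_apply, smul_eq_mul, hA.symm i j],
   by simp only [WithLp.ofLp_smul, Pi.smul_apply, smul_eq_mul, ← mul_sum, hA.tr, mul_zero]⟩
/-- `λ(A) ≥ 0` on symmetric trace-free tensors. [bookkeeping] -/
theorem lam_nonneg {A : Tens3} (hA : IsSymTF A) : 0 ≤ lam A := lam_nonneg_of_sum_diag_eq_zero A hA.tr
/-- `λ(−A) ≥ 0` on symmetric trace-free tensors. [bookkeeping] -/
theorem lam_neg_nonneg {A : Tens3} (hA : IsSymTF A) : 0 ≤ lam (-A) := hA.neg.lam_nonneg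

/-- `‖A‖² ≤ 36 λ(A)²` (tree `norm_le_six_mul_lam`). -/
theorem norm_sq_le {A : Tens3} (hA : IsSymTF A) : ‖A‖ ^ 2 ≤ 36 * lam A ^ 2 := by
  have h := norm_le_six_mul_lam hA.symm hA.tr
  nlinarith [norm_nonneg A, hA.lam_nonneg]
/-- `‖A‖² ≤ 36 λ(−A)²` on symmetric trace-free tensors. [bookkeeping] -/
theorem norm_sq_le_neg {A : Tens3} (hA : IsSymTF A) : ‖A‖ ^ 2 ≤ 36 * lam (-A) ^ 2 := by
  have h := hA.neg.norm_sq_le; rwa [norm_neg] at h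

end IsSymTF
/-- Positive homogeneity `λ(tA) = tλ(A)`, `t ≥ 0`. [folklore] -/
theorem lam_smul {t : ℝ} (ht : 0 ≤ t) (A : Tens3) : lam (t • A) = t * lam A := by
  refine le_antisymm (lam_smul_le ht A) ?_
  rcases ht.eq_or_lt with rfl | ht'
  · simp [lam_zero]
  · have h := lam_smul_le (inv_nonneg.2 ht'.le) (t • A)
    rw [smul_smul, inv_mul_cancel₀ ht'.ne', one_smul] at h
    calc t * lam A ≤ t * (t⁻¹ * lam (t • A)) := mul_le_mul_of_nonneg_left h ht'.le
      _ = lam (t • A) := by rw [← mul_assoc, mul_inv_cancel₀ ht'.ne', one_mul]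

/-- The CORE DENSITY `f_q(A) = (λ(A)²)^{q/2} + (λ(−A)²)^{q/2}` (`= λ₁^q + (−λ₃)^q` on symmetric
trace-free tensors; written through squares so that it is defined, even and non-negative on all
flat tensors). [ours] -/
def coreDensity (q : ℝ) (A : Tens3) : ℝ := (lam A ^ 2) ^ (q / 2) + (lam (-A) ^ 2) ^ (q / 2)

/-- The NORM DENSITY `(‖A‖²)^{q/2} = ‖A‖^q`. [ours; bookkeeping] -/
def normDensity (q : ℝ) (A : Tens3) : ℝ := (‖A‖ ^ 2) ^ (q / 2)
/-- `(x²)^{q/2} = x^q` for `x ≥ 0`. [folklore] -/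
theorem sq_rpow_half {x q : ℝ} (hx : 0 ≤ x) : (x ^ 2) ^ (q / 2) = x ^ q := by
  rw [← Real.rpow_natCast, ← Real.rpow_mul hx]; congr 1; push_cast; ring
/-- `f_q(A) = λ(A)^q + λ(−A)^q` on symmetric trace-free tensors. [bookkeeping] -/
theorem coreDensity_eq {q : ℝ} {A : Tens3} (hA : IsSymTF A) :
    coreDensity q A = lam A ^ q + lam (-A) ^ q := by
  rw [coreDensity, sq_rpow_half hA.lam_nonneg, sq_rpow_half hA.lam_neg_nonneg]
/-- `normDensity q A = ‖A‖^q`. [bookkeeping] -/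
theorem normDensity_eq (q : ℝ) (A : Tens3) : normDensity q A = ‖A‖ ^ q := by
  rw [normDensity, sq_rpow_half (norm_nonneg A)]
/-- `f_q ≥ 0`. [bookkeeping] -/
theorem coreDensity_nonneg (q : ℝ) (A : Tens3) : 0 ≤ coreDensity q A :=
  add_nonneg (Real.rpow_nonneg (sq_nonneg _) _) (Real.rpow_nonneg (sq_nonneg _) _)
/-- `normDensity q ≥ 0`. [bookkeeping] -/
theorem normDensity_nonneg (q : ℝ) (A : Tens3) : 0 ≤ normDensity q A := Real.rpow_nonneg (sq_nonneg _) _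
/-- `f_q` is even. [bookkeeping] -/
theorem coreDensity_neg (q : ℝ) (A : Tens3) : coreDensity q (-A) = coreDensity q A := by
  rw [coreDensity, coreDensity, neg_neg, add_comm]
/-- `normDensity q` is even. [bookkeeping] -/
theorem normDensity_neg (q : ℝ) (A : Tens3) : normDensity q (-A) = normDensity q A := by
  rw [normDensity, normDensity, norm_neg]
/-- `f_q` is positively `q`-homogeneous. [bookkeeping] -/
theorem coreDensity_smul (q : ℝ) {t : ℝ} (ht : 0 ≤ t) (A : Tens3) :
    coreDensity q (t • A) = t ^ q * coreDensity q A := by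
  have h1 : lam (t • A) ^ 2 = t ^ 2 * lam A ^ 2 := by rw [lam_smul ht]; ring
  have h2 : lam (-(t • A)) ^ 2 = t ^ 2 * lam (-A) ^ 2 := by rw [← smul_neg, lam_smul ht]; ring
  rw [coreDensity, coreDensity, h1, h2, Real.mul_rpow (sq_nonneg t) (sq_nonneg _),
    Real.mul_rpow (sq_nonneg t) (sq_nonneg _), sq_rpow_half ht]
  ring
/-- `normDensity q` is positively `q`-homogeneous. [bookkeeping] -/
theorem normDensity_smul (q : ℝ) {t : ℝ} (ht : 0 ≤ t) (A : Tens3) :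
    normDensity q (t • A) = t ^ q * normDensity q A := by
  rw [normDensity, normDensity, norm_smul, Real.norm_of_nonneg ht, mul_pow,
    Real.mul_rpow (sq_nonneg t) (sq_nonneg _), sq_rpow_half ht]
/-- `f_q` is continuous (`q > 0`). [bookkeeping] -/
theorem continuous_coreDensity {q : ℝ} (hq : 0 < q) : Continuous (coreDensity q) := by
  have hc : Continuous fun x : ℝ => x ^ (q / 2) := Real.continuous_rpow_const (by linarith)
  exact ((hc.comp (continuous_lam.pow 2)).add
    (hc.comp ((continuous_lam.comp continuous_neg).pow 2)))
/-- `normDensity q` is continuous (`q > 0`). [bookkeeping] -/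
theorem continuous_normDensity {q : ℝ} (hq : 0 < q) : Continuous (normDensity q) :=
  (Real.continuous_rpow_const (by linarith)).comp (continuous_norm.pow 2)

/-- `f_q ≥ 2·(‖A‖²/36)^{q/2}` on symmetric trace-free tensors (`λ₁, −λ₃ ≥ ‖A‖/6`). [ours] -/
theorem two_mul_rpow_le_coreDensity {q : ℝ} (hq : 0 < q) {A : Tens3} (hA : IsSymTF A) :
    2 * (‖A‖ ^ 2 / 36) ^ (q / 2) ≤ coreDensity q A := by
  have h1 : (‖A‖ ^ 2 / 36) ^ (q / 2) ≤ (lam A ^ 2) ^ (q / 2) :=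
    Real.rpow_le_rpow (by positivity) (by linarith [hA.norm_sq_le]) (by linarith)
  have h2 : (‖A‖ ^ 2 / 36) ^ (q / 2) ≤ (lam (-A) ^ 2) ^ (q / 2) :=
    Real.rpow_le_rpow (by positivity) (by linarith [hA.norm_sq_le_neg]) (by linarith)
  unfold coreDensity; linarith

/-- `f_q ≤ 2·‖A‖^q` (as `(‖A‖²)^{q/2}`; `λ ≤ ‖·‖`). [ours] -/
theorem coreDensity_le_two_mul_normDensity {q : ℝ} (hq : 0 < q) (A : Tens3) :
    coreDensity q A ≤ 2 * normDensity q A := by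
  have ha : lam A ^ 2 ≤ ‖A‖ ^ 2 := by
    have := abs_lam_le_norm A; nlinarith [abs_nonneg (lam A), sq_abs (lam A)]
  have hb : lam (-A) ^ 2 ≤ ‖A‖ ^ 2 := by
    have := abs_lam_le_norm (-A); rw [norm_neg] at this
    nlinarith [abs_nonneg (lam (-A)), sq_abs (lam (-A))]
  have h1 : (lam A ^ 2) ^ (q / 2) ≤ (‖A‖ ^ 2) ^ (q / 2) :=
    Real.rpow_le_rpow (sq_nonneg _) ha (by linarith)
  have h2 : (lam (-A) ^ 2) ^ (q / 2) ≤ (‖A‖ ^ 2) ^ (q / 2) :=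
    Real.rpow_le_rpow (sq_nonneg _) hb (by linarith)
  unfold coreDensity normDensity; linarith

/-! ## 3. The tangent line of `s ↦ s^p` and the second-difference FLOOR of the core density -/

/-- **Tangent line of `s ↦ s^p` (`p ≥ 1`) on `[0, ∞)`**: `m^p + p·m^{p−1}·(a − m) ≤ a^p`
(Bernoulli). [folklore] -/
theorem rpow_tangent_le {m a p : ℝ} (hm : 0 ≤ m) (ha : 0 ≤ a) (hp : 1 ≤ p) :
    m ^ p + p * m ^ (p - 1) * (a - m) ≤ a ^ p := by
  rcases hm.eq_or_lt with rfl | hm'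
  · rcases hp.eq_or_lt with rfl | hp'
    · simp
    · rw [Real.zero_rpow (by linarith), Real.zero_rpow (by linarith)]
      simpa using Real.rpow_nonneg ha p
  · have hs : -1 ≤ a / m - 1 := by
      have : 0 ≤ a / m := div_nonneg ha hm'.le
      linarith
    have hB := one_add_mul_self_le_rpow_one_add hs hp
    have e1 : (1 + (a / m - 1)) = a / m := by ring
    rw [e1, Real.div_rpow ha hm'.le] at hB
    have hmp : 0 < m ^ p := Real.rpow_pos_of_pos hm' p
    rw [Real.rpow_sub_one hm'.ne']
    have key : m ^ p * (1 + p * (a / m - 1)) ≤ m ^ p * (a ^ p / m ^ p) :=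
      mul_le_mul_of_nonneg_left hB hmp.le
    rw [mul_div_cancel₀ _ hmp.ne'] at key
    have e2 : m ^ p * (1 + p * (a / m - 1)) = m ^ p + p * (m ^ p / m) * (a - m) := by
      have hm0 : m ≠ 0 := hm'.ne'
      calc m ^ p * (1 + p * (a / m - 1)) = m ^ p + p * m ^ p * ((a - m) / m) := by
            rw [sub_div, div_self hm0]; ring
        _ = m ^ p + p * (m ^ p / m) * (a - m) := by
            rw [div_eq_mul_inv (m ^ p) m, div_eq_mul_inv (a - m) m]; ring
    linarith [e2]

/-- Squares of non-negative convex functions have non-negative second differences: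
`2φ(B)² ≤ φ(B+X)² + φ(B−X)²` when `φ` is convex and `φ(B) ≥ 0`. [folklore] -/
theorem two_mul_sq_le_of_convexOn {φ : Tens3 → ℝ} (hφ : ConvexOn ℝ univ φ) {B : Tens3} (h0 : 0 ≤ φ B)
    (X : Tens3) : 2 * φ B ^ 2 ≤ φ (B + X) ^ 2 + φ (B - X) ^ 2 := by
  have hmid : φ B ≤ (1 / 2 : ℝ) * φ (B + X) + (1 / 2 : ℝ) * φ (B - X) := by
    have h := hφ.2 (mem_univ (B + X)) (mem_univ (B - X)) (by norm_num : (0 : ℝ) ≤ 1 / 2)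
      (by norm_num : (0 : ℝ) ≤ 1 / 2) (by norm_num)
    have e : (1 / 2 : ℝ) • (B + X) + (1 / 2 : ℝ) • (B - X) = B := by module
    rw [e] at h
    simpa [smul_eq_mul] using h
  nlinarith [sq_nonneg (φ (B + X) - φ (B - X)), hmid, h0]

/-- `g` is convex. [ours; as in the staged K7] -/
theorem convexOn_halfGapDensity : ConvexOn ℝ univ (halfGapDensity : Tens3 → ℝ) := by
  have h := (convexOn_lam (d := Fin 3)).add (convexOn_lam_neg (d := Fin 3))
  refine ⟨convex_univ, fun A _ B _ a b ha hb hab => ?_⟩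
  have := h.2 (mem_univ A) (mem_univ B) ha hb hab
  simp only [Pi.add_apply, smul_eq_mul, halfGapDensity] at this ⊢
  nlinarith [this]

/-- The sum `u₁ + u₂ = λ(A)² + λ(−A)²` has second differences `≥ (2/3)‖X‖²` on symmetric
trace-free tensors (identity of §1 + parallelogram law + convexity of `g²`). [ours] -/
theorem secondDiff_sq_sum_ge {B X : Tens3} (hB : IsSymTF B) (hX : IsSymTF X) :
    2 / 3 * ‖X‖ ^ 2 ≤ (lam (B + X) ^ 2 + lam (-(B + X)) ^ 2) + (lam (B - X) ^ 2 + lam (-(B - X)) ^ 2)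
      - 2 * (lam B ^ 2 + lam (-B) ^ 2) := by
  have hp := hB.add hX; have hm := hB.sub hX
  rw [lam_sq_add_lam_neg_sq_eq hp.symm hp.tr, lam_sq_add_lam_neg_sq_eq hm.symm hm.tr,
    lam_sq_add_lam_neg_sq_eq hB.symm hB.tr]
  have hpar : ‖B + X‖ ^ 2 + ‖B - X‖ ^ 2 = 2 * (‖B‖ ^ 2 + ‖X‖ ^ 2) :=
    parallelogram_law_with_norm ℝ B X
  have hg : 2 * halfGapDensity B ^ 2 ≤ halfGapDensity (B + X) ^ 2 + halfGapDensity (B - X) ^ 2 :=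
    two_mul_sq_le_of_convexOn convexOn_halfGapDensity
      (by unfold halfGapDensity; linarith [hB.lam_nonneg, hB.lam_neg_nonneg]) X
  nlinarith [hpar, hg]

/-- **SECOND-DIFFERENCE FLOOR of the core density** on symmetric trace-free tensors, `q ≥ 2`:
`f_q(B+X) + f_q(B−X) − 2f_q(B) ≥ (q/3)·(‖B‖²/36)^{q/2−1}·‖X‖²` (tangent line of `s ↦ s^{q/2}` at
`uᵢ(B)`, the floors `uᵢ(B) ≥ ‖B‖²/36`, and §1). No smoothness of `λ` is used. [ours] -/
theorem coreDensity_secondDiff_ge {q : ℝ} (hq : 2 ≤ q) {B X : Tens3} (hB : IsSymTF B)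
    (hX : IsSymTF X) :
    q / 3 * (‖B‖ ^ 2 / 36) ^ (q / 2 - 1) * ‖X‖ ^ 2 ≤
      coreDensity q (B + X) + coreDensity q (B - X) - 2 * coreDensity q B := by
  set p : ℝ := q / 2 with hpdef
  have hp1 : 1 ≤ p := by rw [hpdef]; linarith
  have hp0 : 0 ≤ p - 1 := by linarith
  -- the four tangent inequalities
  set u1 : ℝ := lam B ^ 2; set u2 : ℝ := lam (-B) ^ 2
  set a1 : ℝ := lam (B + X) ^ 2; set b1 : ℝ := lam (B - X) ^ 2
  set a2 : ℝ := lam (-(B + X)) ^ 2; set b2 : ℝ := lam (-(B - X)) ^ 2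
  have t1 := rpow_tangent_le (sq_nonneg (lam B)) (sq_nonneg (lam (B + X))) hp1
  have t2 := rpow_tangent_le (sq_nonneg (lam B)) (sq_nonneg (lam (B - X))) hp1
  have t3 := rpow_tangent_le (sq_nonneg (lam (-B))) (sq_nonneg (lam (-(B + X)))) hp1
  have t4 := rpow_tangent_le (sq_nonneg (lam (-B))) (sq_nonneg (lam (-(B - X)))) hp1
  -- non-negative second differences of u₁, u₂
  have d1 : 2 * u1 ≤ a1 + b1 := two_mul_sq_le_of_convexOn convexOn_lam hB.lam_nonneg X
  have d2 : 2 * u2 ≤ a2 + b2 := by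
    have h := two_mul_sq_le_of_convexOn (convexOn_lam_neg (d := Fin 3)) hB.lam_neg_nonneg X
    beta_reduce at h
    exact h
  -- the floors φ'(uᵢ(B)) ≥ φ'(‖B‖²/36)
  have hfl : 0 ≤ ‖B‖ ^ 2 / 36 := by positivity
  have m1 : (‖B‖ ^ 2 / 36) ^ (p - 1) ≤ u1 ^ (p - 1) :=
    Real.rpow_le_rpow hfl (by simp only [u1]; linarith [hB.norm_sq_le]) hp0
  have m2 : (‖B‖ ^ 2 / 36) ^ (p - 1) ≤ u2 ^ (p - 1) :=
    Real.rpow_le_rpow hfl (by simp only [u2]; linarith [hB.norm_sq_le_neg]) hp0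
  have hsum := secondDiff_sq_sum_ge hB hX
  have hF0 : 0 ≤ (‖B‖ ^ 2 / 36) ^ (p - 1) := Real.rpow_nonneg hfl _
  have hpp : 0 ≤ p := by linarith
  -- assemble
  have key : p * (‖B‖ ^ 2 / 36) ^ (p - 1) * ((a1 + b1 - 2 * u1) + (a2 + b2 - 2 * u2)) ≤
      p * u1 ^ (p - 1) * (a1 + b1 - 2 * u1) + p * u2 ^ (p - 1) * (a2 + b2 - 2 * u2) := by
    have k1 : p * (‖B‖ ^ 2 / 36) ^ (p - 1) * (a1 + b1 - 2 * u1) ≤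
        p * u1 ^ (p - 1) * (a1 + b1 - 2 * u1) :=
      mul_le_mul_of_nonneg_right (mul_le_mul_of_nonneg_left m1 hpp) (by linarith)
    have k2 : p * (‖B‖ ^ 2 / 36) ^ (p - 1) * (a2 + b2 - 2 * u2) ≤
        p * u2 ^ (p - 1) * (a2 + b2 - 2 * u2) :=
      mul_le_mul_of_nonneg_right (mul_le_mul_of_nonneg_left m2 hpp) (by linarith)
    linarith
  have hq3 : q / 3 * (‖B‖ ^ 2 / 36) ^ (q / 2 - 1) * ‖X‖ ^ 2 =
      p * (‖B‖ ^ 2 / 36) ^ (p - 1) * (2 / 3 * ‖X‖ ^ 2) := by rw [hpdef]; ring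
  rw [hq3]
  have hle : p * (‖B‖ ^ 2 / 36) ^ (p - 1) * (2 / 3 * ‖X‖ ^ 2) ≤
      p * (‖B‖ ^ 2 / 36) ^ (p - 1) * ((a1 + b1 - 2 * u1) + (a2 + b2 - 2 * u2)) :=
    mul_le_mul_of_nonneg_left (by simp only [a1, b1, u1, a2, b2, u2]; linarith [hsum])
      (mul_nonneg hpp hF0)
  unfold coreDensity
  simp only [← hpdef]
  linarith [key, hle, t1, t2, t3, t4]

end TopEig

end Summit.NavierStokesRegularity.FunctionalMining
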